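import Literature.Analysis.FluidPDE.Ferrari1993LogEstimateReduction
import Literature.Analysis.FluidPDE.PeriodicCylinderGagliardoNirenberg
import Literature.Analysis.FluidPDE.SwirlTransportProofs
import Literature.Analysis.FluidPDE.AxisymVorticityAlgebra
import Mathlib.Analysis.Calculus.FDeriv.Symmetric
import HarnessLib

/-!
# Calculus within the closed cylinder: derivations, the rotation generator, `r ∂_r`, the
Laplacian, and integration by parts on the period cell

Topic `Literature/Analysis/FluidPDE`. Infrastructure for the `H³` regularity of the Neumann
problem of the Euler pressure in the periodic cylinder `{r < 1} × ℝ/Lℤ` (Ferrari 1993, Lemma 2,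
pp. 280–281: `|∇p|_{H^s} ≤ C |u|_{W^{1,∞}} |u|_{H^s}` via the Neumann problem (10)–(12); named fact
`Ferrari1993_periodicCylinderPressureEstimate` of `Ferrari1993EnergyInequalityReduction.lean`). The
regularity proof differentiates the equation and the boundary condition along the **tangential
Killing fields** of the cylinder — the rotation generator `J x = (−x₁, x₀, 0)` (`∂_θ`) and the axial
direction `e₂` (`∂_z`) — and recovers normal derivatives from the polar form of the Laplacian,
`r²(∂₀² + ∂₁²) = (x_h·∇)² + ∂_J²` with `x_h = (x₀, x₁, 0)` (`x_h·∇ = r∂_r`). Every field involved is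
`C^∞` on the **closed** cylinder `{r ≤ 1}` only (time slices of `IsPeriodicCylinderEulerSolution`), so
all derivatives are taken *within* the closed cylinder (`fderivWithin`), where they are genuine
(the closed cylinder is a convex set of unique differentiability), smooth up to the wall, and equal
to the classical ones on the open cylinder. This file provides that calculus; all statements are
folklore.

## Contents

* `cylDeriv V f = (x ↦ D f|_{{r ≤ 1}}(x)(V x))`, the derivative along a vector field within the
  closed cylinder, and words `cylWord`; smoothness on the closed cylinder, agreement with `fderiv`
  on the open cylinder, congruence (only values on the closed cylinder matter), linearity and the
  Leibniz rules (scalar, `•`, inner product, continuous linear maps), and the **commutator formula**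
  `∂_V ∂_W − ∂_W ∂_V = ∂_{[V,W]}` (`cylDeriv_comm_sub`; symmetry of the second derivative within,
  Mathlib's `ContDiffWithinAt.isSymmSndFDerivWithinAt`).
* The fields: standard basis `cylBasis`, the generator `rotGen` (tree), the horizontal position
  `horizontalProj` (tree) as a continuous linear map `horizontalProjL`; the expansions
  `∂_{x_h} = x₀∂₀ + x₁∂₁`, `∂_J = x₀∂₁ − x₁∂₀`, `r²∂₀ = x₀∂_{x_h} − x₁∂_J`, `r²∂₁ = x₁∂_{x_h} + x₀∂_J`;
  pointwise bounds `‖∂_J f‖, ‖∂_{x_h} f‖, ‖∂ᵢ f‖ ≤ ‖Df|_K‖ ≤ Σᵢ ‖∂ᵢ f‖` on the closed cylinder;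
  the commutation relations `[∂_J, ∂_{x_h}] = [∂_J, ∂₂] = [∂_{x_h}, ∂₂] = [∂ᵢ, ∂ⱼ] = 0`,
  `[∂₀, ∂_J] = ∂₁`, `[∂₁, ∂_J] = −∂₀`, `[∂ᵢ, ∂_{x_h}] = ∂_{(eᵢ)_h}`.
* Periodicity in `z` is inherited by derivatives along `z`-invariant fields
  (`IsAxiallyPeriodic.cylDeriv`, from the tree's `IsAxiallyPeriodic.fderivWithin_closure`), and
  **tangential derivatives (`a ∂_J + b ∂₂`) of a function vanishing on the wall vanish on the wall**
  (`cylDeriv_eq_zero_of_wall_of_tangent`: the curves `s ↦ R_s x`, `s ↦ x + s e₂` stay on the wall).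
* Gradient, divergence and Laplacian within (`cylGrad`, `cylDiv`, `cylLap`): `⟪∇_K f, v⟫ = Df|_K v`,
  `‖∇_K f‖ = ‖Df|_K‖`, agreement with `gradient` / `VectorCalculus.divergence` on the open cylinder,
  `div_K ∇_K = Δ_K`, `div (∇f) = Δ_K f` on the open cylinder, `Δ_K ∂ᵢ = ∂ᵢ Δ_K`,
  **`Δ_K ∂_J = ∂_J Δ_K`** (`cylLap_cylDeriv_rotGen`) and the **polar identity**
  `r²(∂₀² + ∂₁²) f = ∂_{x_h}∂_{x_h} f + ∂_J ∂_J f` (`sq_radius_smul_horizontalLap`).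
* Integration by parts on the period cell against tangential periodic fields
  (`setIntegral_mul_divergence_add_fderiv_eq_zero`, from the tree's Gauss–Green identity
  `setIntegral_divergence_cylinderCell_eq_zero`): `∫_cell ∂_J φ = 0`, `∫_cell ∂₂ φ = 0`,
  `∫_cell (∂_Z f) g = −∫_cell f (∂_Z g)` for `Z ∈ {J, e₂}`.

Mathlib/tree search: Mathlib has `fderivWithin` calculus, `gradientWithin`, `laplacianWithin` (via
`iteratedFDerivWithin 2`; not used — the recursive `Σᵢ ∂ᵢ∂ᵢ` form matches the tree's Sobolev norms
and the word calculus), `ContDiffWithinAt.isSymmSndFDerivWithinAt`, `PiLp.hasFDerivAt_apply`; tree: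
`rotGen`/`rotGenL`/`hasDerivAt_rotZ_zero` (`SwirlTransportProofs`), `contDiff_rotGen`, `fderiv_rotGen`,
`norm_rotGen` (`AxisymNoSwirlScalarEq`, `AxisymVorticityAlgebra`), `horizontalProj`
(`ChenHouContinuationProofs`), `IsAxiallyPeriodic.fderivWithin_closure`
(`PeriodicCylinderGagliardoNirenberg`), Gauss–Green on the cell (`Ferrari1993LogEstimateReduction`,
`PeriodicCylinderGaussGreen`), `divergence_smul_apply` (`WholeSpaceIBP`); no calculus of derivations
within the closed cylinder existed (`lean search 'cylDeriv|fderivWithin.*closure.*unitCylinder'`).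
-/

noncomputable section

open MeasureTheory Set Function Filter Topology TopologicalSpace WithLp
open scoped ContDiff NNReal ENNReal InnerProductSpace RealInnerProductSpace

namespace Literature.Analysis.FluidPDE

/-- Local notation for physical space `ℝ³ = EuclideanSpace ℝ (Fin 3)`. -/
local notation "ℝ³" => EuclideanSpace ℝ (Fin 3)

/-- Local notation for the closed unit cylinder `{r ≤ 1}`. -/
local notation "𝕂" => closure (SetLike.coe unitCylinder : Set (EuclideanSpace ℝ (Fin 3)))

section CylDeriv

variable {F : Type*} [NormedAddCommGroup F] [NormedSpace ℝ F]

/-! ### Derivatives along vector fields within the closed cylinder -/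

/-- The derivative of `f` along the vector field `V`, taken **within the closed cylinder**
`{r ≤ 1}`: `x ↦ D f|_{{r ≤ 1}}(x) (V x)`. For `f` smooth on the closed cylinder this is again smooth
on the closed cylinder (no junk at the wall), and on the open cylinder it is the classical
directional derivative `Df(x)(V x)`. [folklore] -/
def cylDeriv (V : ℝ³ → ℝ³) (f : ℝ³ → F) : ℝ³ → F :=
  fun x => fderivWithin ℝ f 𝕂 x (V x)

/-- Iterated derivatives within the closed cylinder along a word of vector fields (head =
outermost derivative). [folklore] -/
def cylWord : List (ℝ³ → ℝ³) → (ℝ³ → F) → ℝ³ → F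
  | [], f => f
  | V :: Vs, f => cylDeriv V (cylWord Vs f)

/-- Unfolding `cylDeriv`. [folklore] -/
theorem cylDeriv_apply (V : ℝ³ → ℝ³) (f : ℝ³ → F) (x : ℝ³) :
    cylDeriv V f x = fderivWithin ℝ f 𝕂 x (V x) := rfl

/-- The empty word does not differentiate. [folklore] -/
@[simp] theorem cylWord_nil (f : ℝ³ → F) : cylWord [] f = f := rfl

/-- `∂_{V W…} f = ∂_V (∂_{W…} f)`. [folklore] -/
theorem cylWord_cons (V : ℝ³ → ℝ³) (Vs : List (ℝ³ → ℝ³)) (f : ℝ³ → F) :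
    cylWord (V :: Vs) f = cylDeriv V (cylWord Vs f) := rfl

/-- Words compose by concatenation. [folklore] -/
theorem cylWord_append (Vs Ws : List (ℝ³ → ℝ³)) (f : ℝ³ → F) :
    cylWord (Vs ++ Ws) f = cylWord Vs (cylWord Ws f) := by
  induction Vs with
  | nil => rfl
  | cons V Vs ih => simp only [List.cons_append, cylWord_cons, ih]

/-- The closed cylinder is a set of unique differentiability (recorded under a short name). [folklore] -/
theorem uniqueDiffOn_K : UniqueDiffOn ℝ (𝕂 : Set ℝ³) := uniqueDiffOn_closure_unitCylinder

/-- The closed cylinder lies in the closure of its interior. [folklore] -/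
theorem K_subset_closure_interior : (𝕂 : Set ℝ³) ⊆ closure (interior 𝕂) :=
  closure_mono (unitCylinder.isOpen.subset_interior_iff.mpr subset_closure)

/-- **Smoothness**: `∂_V f` is smooth on the closed cylinder if `f` is and `V` is smooth. [folklore] -/
theorem contDiffOn_cylDeriv {V : ℝ³ → ℝ³} (hV : ContDiff ℝ ∞ V) {f : ℝ³ → F}
    (hf : ContDiffOn ℝ ∞ f 𝕂) : ContDiffOn ℝ ∞ (cylDeriv V f) 𝕂 :=
  (hf.fderivWithin uniqueDiffOn_K (by simp)).clm_apply hV.contDiffOn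

/-- Smoothness of word derivatives on the closed cylinder. [folklore] -/
theorem contDiffOn_cylWord {Vs : List (ℝ³ → ℝ³)} (hVs : ∀ V ∈ Vs, ContDiff ℝ ∞ V) {f : ℝ³ → F}
    (hf : ContDiffOn ℝ ∞ f 𝕂) : ContDiffOn ℝ ∞ (cylWord Vs f) 𝕂 := by
  induction Vs with
  | nil => exact hf
  | cons V Vs ih =>
    exact contDiffOn_cylDeriv (hVs V (List.mem_cons_self ..)) (ih fun W hW => hVs W (List.mem_cons_of_mem _ hW))

/-- **On the open cylinder `∂_V f` is the classical directional derivative.** [folklore] -/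
theorem cylDeriv_eq_fderiv (V : ℝ³ → ℝ³) (f : ℝ³ → F) {x : ℝ³} (hx : x ∈ (unitCylinder : Set ℝ³)) :
    cylDeriv V f x = fderiv ℝ f x (V x) := by
  rw [cylDeriv_apply, fderivWithin_of_mem_nhds (closure_unitCylinder_mem_nhds hx)]

/-- **Congruence**: `∂_V f (x)` only depends on the values of `f` on the closed cylinder. [folklore] -/
theorem cylDeriv_congr {V : ℝ³ → ℝ³} {f g : ℝ³ → F} (h : EqOn f g 𝕂) {x : ℝ³} (hx : x ∈ 𝕂) :
    cylDeriv V f x = cylDeriv V g x := by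
  rw [cylDeriv_apply, cylDeriv_apply, fderivWithin_congr h (h hx)]

/-- Congruence for words. [folklore] -/
theorem cylWord_congr (Vs : List (ℝ³ → ℝ³)) {f g : ℝ³ → F} (h : EqOn f g 𝕂) :
    EqOn (cylWord Vs f) (cylWord Vs g) 𝕂 := by
  induction Vs with
  | nil => exact h
  | cons V Vs ih => exact fun x hx => cylDeriv_congr ih hx

/-- The field enters pointwise and linearly: `∂_{V} f (x)` only depends on `V x`. [folklore] -/
theorem cylDeriv_congr_field {V W : ℝ³ → ℝ³} (f : ℝ³ → F) {x : ℝ³} (h : V x = W x) :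
    cylDeriv V f x = cylDeriv W f x := by
  rw [cylDeriv_apply, cylDeriv_apply, h]

/-- Linearity in the field: `∂_{V + W} f = ∂_V f + ∂_W f`. [folklore] -/
theorem cylDeriv_field_add (V W : ℝ³ → ℝ³) (f : ℝ³ → F) (x : ℝ³) :
    cylDeriv (fun y => V y + W y) f x = cylDeriv V f x + cylDeriv W f x := by
  simp only [cylDeriv_apply, map_add]

/-- Linearity in the field: `∂_{c V} f = c ∂_V f` for a scalar function `c`. [folklore] -/
theorem cylDeriv_field_smul (c : ℝ³ → ℝ) (V : ℝ³ → ℝ³) (f : ℝ³ → F) (x : ℝ³) :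
    cylDeriv (fun y => c y • V y) f x = c x • cylDeriv V f x := by
  simp only [cylDeriv_apply, map_smul]

/-- Linearity in the field: `∂_{V - W} f = ∂_V f - ∂_W f`. [folklore] -/
theorem cylDeriv_field_sub (V W : ℝ³ → ℝ³) (f : ℝ³ → F) (x : ℝ³) :
    cylDeriv (fun y => V y - W y) f x = cylDeriv V f x - cylDeriv W f x := by
  simp only [cylDeriv_apply, map_sub]

/-! ### Linearity and Leibniz rules in the function -/

section Rules

variable {V : ℝ³ → ℝ³} {x : ℝ³}

/-- Differentiability within the closed cylinder of a function smooth there. [folklore] -/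
theorem differentiableWithinAt_K {G : Type*} [NormedAddCommGroup G] [NormedSpace ℝ G]
    {f : ℝ³ → G} (hf : ContDiffOn ℝ ∞ f 𝕂) (hx : x ∈ 𝕂) : DifferentiableWithinAt ℝ f 𝕂 x :=
  hf.differentiableOn (by simp) x hx

/-- `∂_V (f + g) = ∂_V f + ∂_V g` on the closed cylinder. [folklore] -/
theorem cylDeriv_add {f g : ℝ³ → F} (hf : ContDiffOn ℝ ∞ f 𝕂) (hg : ContDiffOn ℝ ∞ g 𝕂)
    (hx : x ∈ 𝕂) : cylDeriv V (fun y => f y + g y) x = cylDeriv V f x + cylDeriv V g x := by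
  simp only [cylDeriv_apply]
  rw [fderivWithin_fun_add (uniqueDiffOn_K x hx) (differentiableWithinAt_K hf hx)
    (differentiableWithinAt_K hg hx)]
  rfl

/-- `∂_V (f - g) = ∂_V f - ∂_V g` on the closed cylinder. [folklore] -/
theorem cylDeriv_sub {f g : ℝ³ → F} (hf : ContDiffOn ℝ ∞ f 𝕂) (hg : ContDiffOn ℝ ∞ g 𝕂)
    (hx : x ∈ 𝕂) : cylDeriv V (fun y => f y - g y) x = cylDeriv V f x - cylDeriv V g x := by
  simp only [cylDeriv_apply]
  rw [fderivWithin_fun_sub (uniqueDiffOn_K x hx) (differentiableWithinAt_K hf hx)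
    (differentiableWithinAt_K hg hx)]
  rfl

/-- `∂_V (−f) = −∂_V f` on the closed cylinder. [folklore] -/
theorem cylDeriv_neg (f : ℝ³ → F) (hx : x ∈ 𝕂) :
    cylDeriv V (fun y => -f y) x = -cylDeriv V f x := by
  simp only [cylDeriv_apply]
  rw [fderivWithin_fun_neg (uniqueDiffOn_K x hx)]
  rfl

/-- `∂_V (a f) = a ∂_V f` for a constant `a`, on the closed cylinder. [folklore] -/
theorem cylDeriv_const_smul (a : ℝ) {f : ℝ³ → F} (hf : ContDiffOn ℝ ∞ f 𝕂) (hx : x ∈ 𝕂) :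
    cylDeriv V (fun y => a • f y) x = a • cylDeriv V f x := by
  simp only [cylDeriv_apply]
  rw [fderivWithin_fun_const_smul (uniqueDiffOn_K x hx) (differentiableWithinAt_K hf hx)]
  rfl

/-- `∂_V` of a constant vanishes. [folklore] -/
theorem cylDeriv_const (c : F) (x : ℝ³) : cylDeriv V (fun _ => c) x = 0 := by
  simp [cylDeriv_apply, fderivWithin_const_apply]

/-- `∂_V` of a finite sum, on the closed cylinder. [folklore] -/
theorem cylDeriv_finset_sum {ι : Type*} (s : Finset ι) {f : ι → ℝ³ → F}
    (hf : ∀ i ∈ s, ContDiffOn ℝ ∞ (f i) 𝕂) (hx : x ∈ 𝕂) :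
    cylDeriv V (fun y => ∑ i ∈ s, f i y) x = ∑ i ∈ s, cylDeriv V (f i) x := by
  classical
  induction s using Finset.induction_on with
  | empty => simp [cylDeriv_const]
  | insert i s hi ih =>
    simp only [Finset.sum_insert hi]
    rw [cylDeriv_add (hf i (Finset.mem_insert_self i s))
      (ContDiffOn.sum fun j hj => hf j (Finset.mem_insert_of_mem hj)) hx,
      ih fun j hj => hf j (Finset.mem_insert_of_mem hj)]

/-- **Leibniz rule** `∂_V (φ • f) = (∂_V φ) • f + φ • ∂_V f` on the closed cylinder. [folklore] -/
theorem cylDeriv_smul {φ : ℝ³ → ℝ} {f : ℝ³ → F} (hφ : ContDiffOn ℝ ∞ φ 𝕂) (hf : ContDiffOn ℝ ∞ f 𝕂)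
    (hx : x ∈ 𝕂) :
    cylDeriv V (fun y => φ y • f y) x = cylDeriv V φ x • f x + φ x • cylDeriv V f x := by
  simp only [cylDeriv_apply]
  rw [fderivWithin_fun_smul (uniqueDiffOn_K x hx) (differentiableWithinAt_K hφ hx)
    (differentiableWithinAt_K hf hx)]
  simp only [add_apply, FunLike.coe_smul, Pi.smul_apply, ContinuousLinearMap.smulRight_apply]
  abel

/-- **Leibniz rule** `∂_V (φ ψ) = (∂_V φ) ψ + φ ∂_V ψ` for scalar functions on the closed cylinder.
[folklore] -/
theorem cylDeriv_mul {φ ψ : ℝ³ → ℝ} (hφ : ContDiffOn ℝ ∞ φ 𝕂) (hψ : ContDiffOn ℝ ∞ ψ 𝕂) (hx : x ∈ 𝕂) :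
    cylDeriv V (fun y => φ y * ψ y) x = cylDeriv V φ x * ψ x + φ x * cylDeriv V ψ x := by
  have h := cylDeriv_smul (V := V) (f := ψ) hφ hψ hx
  simpa only [smul_eq_mul] using h

/-- **Leibniz rule for the inner product** `∂_V ⟪f, g⟫ = ⟪∂_V f, g⟫ + ⟪f, ∂_V g⟫` on the closed
cylinder. [folklore] -/
theorem cylDeriv_inner {G : Type*} [NormedAddCommGroup G] [InnerProductSpace ℝ G] {f g : ℝ³ → G}
    (hf : ContDiffOn ℝ ∞ f 𝕂) (hg : ContDiffOn ℝ ∞ g 𝕂) (hx : x ∈ 𝕂) :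
    cylDeriv V (fun y => ⟪f y, g y⟫) x = ⟪cylDeriv V f x, g x⟫ + ⟪f x, cylDeriv V g x⟫ := by
  simp only [cylDeriv_apply]
  rw [((differentiableWithinAt_K hf hx).hasFDerivWithinAt.inner ℝ
    (differentiableWithinAt_K hg hx).hasFDerivWithinAt).fderivWithin (uniqueDiffOn_K x hx)]
  simp only [ContinuousLinearMap.coe_comp, comp_apply, ContinuousLinearMap.prod_apply,
    fderivInnerCLM_apply]
  rw [add_comm]

/-- A continuous linear map passes through `∂_V`: `∂_V (l ∘ f) = l (∂_V f)`. [folklore] -/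
theorem cylDeriv_clm_comp {G : Type*} [NormedAddCommGroup G] [NormedSpace ℝ G] (l : F →L[ℝ] G)
    {f : ℝ³ → F} (hf : ContDiffOn ℝ ∞ f 𝕂) (hx : x ∈ 𝕂) :
    cylDeriv V (fun y => l (f y)) x = l (cylDeriv V f x) := by
  simp only [cylDeriv_apply]
  have h : HasFDerivWithinAt (fun y => l (f y)) (l.comp (fderivWithin ℝ f 𝕂 x)) 𝕂 x :=
    l.hasFDerivAt.comp_hasFDerivWithinAt x (differentiableWithinAt_K hf hx).hasFDerivWithinAt
  rw [h.fderivWithin (uniqueDiffOn_K x hx)]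
  rfl

/-- The derivative of a globally differentiable function (a field, a coefficient) within the
closed cylinder is its classical derivative. [folklore] -/
theorem cylDeriv_eq_fderiv_of_differentiableAt {G : Type*} [NormedAddCommGroup G] [NormedSpace ℝ G]
    {W : ℝ³ → G} (hW : DifferentiableAt ℝ W x) (hx : x ∈ 𝕂) :
    cylDeriv V W x = fderiv ℝ W x (V x) := by
  rw [cylDeriv_apply, hW.fderivWithin (uniqueDiffOn_K x hx)]

end Rules

/-! ### The commutator of two derivations -/

/-- **Commutator formula** on the closed cylinder: for vector fields `V, W` differentiable at `x`
(with derivatives `DV(x)`, `DW(x)`) and `f` smooth on the closed cylinder,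
`∂_V ∂_W f − ∂_W ∂_V f = ∂_{[V, W]} f` at `x`, `[V, W](x) = DW(x)(V x) − DV(x)(W x)` (symmetry of the
second derivative within the closed cylinder, `ContDiffWithinAt.isSymmSndFDerivWithinAt`). [folklore] -/
theorem cylDeriv_comm_sub {V W : ℝ³ → ℝ³} {x : ℝ³} (hV : DifferentiableAt ℝ V x)
    (hW : DifferentiableAt ℝ W x) {f : ℝ³ → F} (hf : ContDiffOn ℝ ∞ f 𝕂) (hx : x ∈ 𝕂) :
    cylDeriv V (cylDeriv W f) x - cylDeriv W (cylDeriv V f) x =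
      cylDeriv (fun y => fderiv ℝ W y (V y) - fderiv ℝ V y (W y)) f x := by
  set D : ℝ³ → ℝ³ →L[ℝ] F := fderivWithin ℝ f 𝕂 with hD
  have hDd : DifferentiableWithinAt ℝ D 𝕂 x :=
    ((hf.fderivWithin uniqueDiffOn_K (m := 1) (WithTop.coe_le_coe.mpr le_top)).differentiableOn
      one_ne_zero) x hx
  have key : ∀ {A : ℝ³ → ℝ³} (hA : DifferentiableAt ℝ A x) (v : ℝ³),
      fderivWithin ℝ (fun y => D y (A y)) 𝕂 x v = fderivWithin ℝ D 𝕂 x v (A x) + D x (fderiv ℝ A x v) := by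
    intro A hA v
    rw [fderivWithin_clm_apply (uniqueDiffOn_K x hx) hDd (hA.differentiableWithinAt),
      hA.fderivWithin (uniqueDiffOn_K x hx)]
    simp only [add_apply, ContinuousLinearMap.coe_comp, comp_apply,
      ContinuousLinearMap.flip_apply]
    abel
  have hsymm : IsSymmSndFDerivWithinAt ℝ f 𝕂 x :=
    (hf x hx).isSymmSndFDerivWithinAt
      (by simp only [minSmoothness_of_isRCLikeNormedField]; exact WithTop.coe_le_coe.mpr le_top)
      uniqueDiffOn_K (K_subset_closure_interior hx) hx
  show fderivWithin ℝ (fun y => D y (W y)) 𝕂 x (V x) - fderivWithin ℝ (fun y => D y (V y)) 𝕂 x (W x) =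
    D x (fderiv ℝ W x (V x) - fderiv ℝ V x (W x))
  rw [key hW, key hV, hsymm (V x) (W x), map_sub]
  abel

/-- Two derivations along fields with vanishing bracket at `x` commute there. [folklore] -/
theorem cylDeriv_comm {V W : ℝ³ → ℝ³} {x : ℝ³} (hV : DifferentiableAt ℝ V x)
    (hW : DifferentiableAt ℝ W x) (hVW : fderiv ℝ W x (V x) = fderiv ℝ V x (W x)) {f : ℝ³ → F}
    (hf : ContDiffOn ℝ ∞ f 𝕂) (hx : x ∈ 𝕂) :
    cylDeriv V (cylDeriv W f) x = cylDeriv W (cylDeriv V f) x := by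
  have h := cylDeriv_comm_sub hV hW hf hx
  rw [cylDeriv_apply (fun y => fderiv ℝ W y (V y) - fderiv ℝ V y (W y)), hVW, sub_self, map_zero,
    sub_eq_zero] at h
  exact h

end CylDeriv

/-! ### The fields: coordinate directions, the rotation generator, the horizontal position -/

section Fields

variable {F : Type*} [NormedAddCommGroup F] [NormedSpace ℝ F]

/-- The standard basis vector `eᵢ` of `ℝ³`. [folklore] -/
def cylBasis (i : Fin 3) : ℝ³ := EuclideanSpace.single i 1

/-- Components of the standard basis vectors. [folklore] -/
@[simp] theorem cylBasis_apply (i j : Fin 3) : cylBasis i j = if j = i then 1 else 0 := by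
  simp [cylBasis]

/-- The standard basis vectors have norm one. [folklore] -/
@[simp] theorem norm_cylBasis (i : Fin 3) : ‖cylBasis i‖ = 1 := by
  simp [cylBasis]

/-- `⟪eᵢ, v⟫ = vᵢ`. [folklore] -/
theorem inner_cylBasis_left (i : Fin 3) (v : ℝ³) : ⟪cylBasis i, v⟫ = v i := by
  simp [cylBasis, EuclideanSpace.inner_single_left]

/-- `⟪v, eᵢ⟫ = vᵢ`. [folklore] -/
theorem inner_cylBasis_right (i : Fin 3) (v : ℝ³) : ⟪v, cylBasis i⟫ = v i := by
  rw [real_inner_comm, inner_cylBasis_left]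

/-- Expansion of a vector in the standard basis. [folklore] -/
theorem sum_apply_smul_cylBasis (v : ℝ³) : ∑ i, v i • cylBasis i = v := by
  ext j
  simp [Fin.sum_univ_three, cylBasis_apply]
  fin_cases j <;> simp

/-- The horizontal position vector field `x ↦ (x₀, x₁, 0)` as a continuous linear map. [folklore] -/
def horizontalProjL : ℝ³ →L[ℝ] ℝ³ := LinearMap.toContinuousLinearMap horizontalProj

/-- `horizontalProjL` is `horizontalProj`. [folklore] -/
@[simp] theorem horizontalProjL_apply (x : ℝ³) : horizontalProjL x = horizontalProj x := rfl

/-- Components of the horizontal projection. [folklore] -/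
theorem horizontalProj_apply_eq (x : ℝ³) :
    horizontalProj x = (toLp 2 ![x 0, x 1, 0] : ℝ³) := rfl

/-- `(x_h)₀ = x₀`. [folklore] -/
@[simp] theorem horizontalProj_apply_zero (x : ℝ³) : horizontalProj x 0 = x 0 := by
  simp [horizontalProj_apply_eq]

/-- `(x_h)₁ = x₁`. [folklore] -/
@[simp] theorem horizontalProj_apply_one (x : ℝ³) : horizontalProj x 1 = x 1 := by
  simp [horizontalProj_apply_eq]

/-- `(x_h)₂ = 0`. [folklore] -/
@[simp] theorem horizontalProj_apply_two (x : ℝ³) : horizontalProj x 2 = 0 := by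
  simp [horizontalProj_apply_eq]

/-- `x_h = x₀ e₀ + x₁ e₁`. [folklore] -/
theorem horizontalProj_eq_add_cylBasis (x : ℝ³) :
    horizontalProj x = x 0 • cylBasis 0 + x 1 • cylBasis 1 := by
  rw [horizontalProj_apply_eq, toLp_horizontal_eq_add_single]; rfl

/-- `J x = x₀ e₁ − x₁ e₀`. [folklore] -/
theorem rotGen_eq_sub_cylBasis (x : ℝ³) : rotGen x = x 0 • cylBasis 1 - x 1 • cylBasis 0 :=
  rotGen_eq_sub_single x

/-- `J e₀ = e₁`. [folklore] -/
@[simp] theorem rotGen_cylBasis_zero : rotGen (cylBasis 0) = cylBasis 1 := rotGen_single_zero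

/-- `J e₁ = −e₀`. [folklore] -/
@[simp] theorem rotGen_cylBasis_one : rotGen (cylBasis 1) = -cylBasis 0 := rotGen_single_one

/-- `J e₂ = 0`. [folklore] -/
@[simp] theorem rotGen_cylBasis_two : rotGen (cylBasis 2) = 0 := rotGen_single_two

/-- `J (x_h) = J x` (the generator only sees the horizontal part). [folklore] -/
theorem rotGen_horizontalProj (x : ℝ³) : rotGen (horizontalProj x) = rotGen x := by
  ext i; fin_cases i <;> simp [rotGen, horizontalProj_apply_eq]

/-- `(J x)_h = J x` (the generator is horizontal). [folklore] -/
theorem horizontalProj_rotGen (x : ℝ³) : horizontalProj (rotGen x) = rotGen x := by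
  ext i; fin_cases i <;> simp [rotGen, horizontalProj_apply_eq]

/-- `(e₂)_h = 0`. [folklore] -/
@[simp] theorem horizontalProj_cylBasis_two : horizontalProj (cylBasis 2) = 0 := by
  ext i; fin_cases i <;> simp [horizontalProj_apply_eq]

/-- `(e₀)_h = e₀`. [folklore] -/
@[simp] theorem horizontalProj_cylBasis_zero : horizontalProj (cylBasis 0) = cylBasis 0 := by
  ext i; fin_cases i <;> simp [horizontalProj_apply_eq]

/-- `(e₁)_h = e₁`. [folklore] -/
@[simp] theorem horizontalProj_cylBasis_one : horizontalProj (cylBasis 1) = cylBasis 1 := by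
  ext i; fin_cases i <;> simp [horizontalProj_apply_eq]

/-- `‖J x‖ = r`. [folklore] -/
theorem norm_rotGen_eq_cylRadius (x : ℝ³) : ‖rotGen x‖ = cylRadius x := by
  rw [norm_rotGen, cylRadius]

/-- The horizontal projection is smooth (linear). [folklore] -/
theorem contDiff_horizontalProj : ContDiff ℝ ∞ (fun x : ℝ³ => horizontalProj x) := by
  rw [show (fun x : ℝ³ => horizontalProj x) = fun x => horizontalProjL x from rfl]
  exact horizontalProjL.contDiff

/-- The derivative of the horizontal projection is itself. [folklore] -/
theorem fderiv_horizontalProj (x : ℝ³) :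
    fderiv ℝ (fun y : ℝ³ => horizontalProj y) x = horizontalProjL := by
  rw [show (fun x : ℝ³ => horizontalProj x) = fun x => horizontalProjL x from rfl]
  exact horizontalProjL.fderiv

/-- The fields are invariant under the axial translation: `J (x + s e₂) = J x`. [folklore] -/
theorem rotGen_add_axialShift (x : ℝ³) (s : ℝ) :
    rotGen (x + s • EuclideanSpace.single (2 : Fin 3) (1 : ℝ)) = rotGen x := by
  ext i; fin_cases i <;> simp [rotGen]

/-- `(x + s e₂)_h = x_h`. [folklore] -/
theorem horizontalProj_add_axialShift (x : ℝ³) (s : ℝ) :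
    horizontalProj (x + s • EuclideanSpace.single (2 : Fin 3) (1 : ℝ)) = horizontalProj x := by
  ext i; fin_cases i <;> simp [horizontalProj_apply_eq]

/-! ### The partial derivatives, `∂_θ` and `r ∂_r` within the closed cylinder -/

/-- `∂_{x_h} f = x₀ ∂₀ f + x₁ ∂₁ f`. [folklore] -/
theorem cylDeriv_horizontalProj_eq (f : ℝ³ → F) (x : ℝ³) :
    cylDeriv (fun y => horizontalProj y) f x =
      x 0 • cylDeriv (fun _ => cylBasis 0) f x + x 1 • cylDeriv (fun _ => cylBasis 1) f x := by
  simp only [cylDeriv_apply, horizontalProj_eq_add_cylBasis, map_add, map_smul]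

/-- `∂_J f = x₀ ∂₁ f − x₁ ∂₀ f`. [folklore] -/
theorem cylDeriv_rotGen_eq (f : ℝ³ → F) (x : ℝ³) :
    cylDeriv rotGen f x =
      x 0 • cylDeriv (fun _ => cylBasis 1) f x - x 1 • cylDeriv (fun _ => cylBasis 0) f x := by
  simp only [cylDeriv_apply, rotGen_eq_sub_cylBasis, map_sub, map_smul]

/-- On `r > 0`: `r² ∂₀ f = x₀ ∂_{x_h} f − x₁ ∂_J f`. [folklore] -/
theorem sq_smul_cylDeriv_zero_eq (f : ℝ³ → F) (x : ℝ³) :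
    (x 0 ^ 2 + x 1 ^ 2) • cylDeriv (fun _ => cylBasis 0) f x =
      x 0 • cylDeriv (fun y => horizontalProj y) f x - x 1 • cylDeriv rotGen f x := by
  rw [cylDeriv_horizontalProj_eq, cylDeriv_rotGen_eq]
  simp only [smul_add, smul_sub, smul_smul]
  rw [add_smul]
  module

/-- On `r > 0`: `r² ∂₁ f = x₁ ∂_{x_h} f + x₀ ∂_J f`. [folklore] -/
theorem sq_smul_cylDeriv_one_eq (f : ℝ³ → F) (x : ℝ³) :
    (x 0 ^ 2 + x 1 ^ 2) • cylDeriv (fun _ => cylBasis 1) f x =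
      x 1 • cylDeriv (fun y => horizontalProj y) f x + x 0 • cylDeriv rotGen f x := by
  rw [cylDeriv_horizontalProj_eq, cylDeriv_rotGen_eq]
  simp only [smul_add, smul_sub, smul_smul]
  rw [add_smul]
  module

/-- Pointwise bounds: `‖∂_V f (x)‖ ≤ ‖V x‖ ‖D f|_K (x)‖`. [folklore] -/
theorem norm_cylDeriv_le (V : ℝ³ → ℝ³) (f : ℝ³ → F) (x : ℝ³) :
    ‖cylDeriv V f x‖ ≤ ‖V x‖ * ‖fderivWithin ℝ f 𝕂 x‖ := by
  rw [cylDeriv_apply, mul_comm]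
  exact ContinuousLinearMap.le_opNorm _ _

/-- On the closed cylinder, `‖∂_J f‖ ≤ ‖D f|_K‖` (`‖J x‖ = r ≤ 1`). [folklore] -/
theorem norm_cylDeriv_rotGen_le (f : ℝ³ → F) {x : ℝ³} (hx : x ∈ 𝕂) :
    ‖cylDeriv rotGen f x‖ ≤ ‖fderivWithin ℝ f 𝕂 x‖ := by
  refine (norm_cylDeriv_le rotGen f x).trans ?_
  rw [norm_rotGen_eq_cylRadius]
  rw [closure_unitCylinder] at hx
  exact mul_le_of_le_one_left (norm_nonneg _) hx

/-- On the closed cylinder, `‖∂_{x_h} f‖ ≤ ‖D f|_K‖` (`‖x_h‖ = r ≤ 1`). [folklore] -/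
theorem norm_cylDeriv_horizontalProj_le (f : ℝ³ → F) {x : ℝ³} (hx : x ∈ 𝕂) :
    ‖cylDeriv (fun y => horizontalProj y) f x‖ ≤ ‖fderivWithin ℝ f 𝕂 x‖ := by
  refine (norm_cylDeriv_le _ f x).trans ?_
  rw [norm_horizontalProj]
  rw [closure_unitCylinder] at hx
  exact mul_le_of_le_one_left (norm_nonneg _) hx

/-- `‖∂ᵢ f‖ ≤ ‖D f|_K‖`. [folklore] -/
theorem norm_cylDeriv_cylBasis_le (i : Fin 3) (f : ℝ³ → F) (x : ℝ³) :
    ‖cylDeriv (fun _ => cylBasis i) f x‖ ≤ ‖fderivWithin ℝ f 𝕂 x‖ := by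
  refine (norm_cylDeriv_le _ f x).trans ?_
  rw [norm_cylBasis, one_mul]

/-- The operator norm of the derivative within the closed cylinder is controlled by the three
partial derivatives: `‖D f|_K (x)‖ ≤ Σᵢ ‖∂ᵢ f (x)‖`. [folklore] -/
theorem norm_fderivWithin_le_sum_cylDeriv (f : ℝ³ → F) (x : ℝ³) :
    ‖fderivWithin ℝ f 𝕂 x‖ ≤ ∑ i, ‖cylDeriv (fun _ => cylBasis i) f x‖ := by
  refine ContinuousLinearMap.opNorm_le_bound _ (Finset.sum_nonneg fun i _ => norm_nonneg _) ?_
  intro v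
  have hv : v = ∑ i, v i • cylBasis i := (sum_apply_smul_cylBasis v).symm
  conv_lhs => rw [hv]
  rw [map_sum, Finset.sum_mul]
  refine (norm_sum_le _ _).trans (Finset.sum_le_sum fun i _ => ?_)
  rw [map_smul, norm_smul, mul_comm]
  refine mul_le_mul le_rfl ?_ (norm_nonneg _) (norm_nonneg _)
  simpa using PiLp.norm_apply_le v i

/-! ### Commutation relations -/

/-- Constant fields commute: `∂ᵢ ∂ⱼ f = ∂ⱼ ∂ᵢ f` on the closed cylinder. [folklore] -/
theorem cylDeriv_const_comm (v w : ℝ³) {f : ℝ³ → F} (hf : ContDiffOn ℝ ∞ f 𝕂) {x : ℝ³} (hx : x ∈ 𝕂) :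
    cylDeriv (fun _ => v) (cylDeriv (fun _ => w) f) x = cylDeriv (fun _ => w) (cylDeriv (fun _ => v) f) x :=
  cylDeriv_comm (differentiableAt_const v) (differentiableAt_const w) (by simp) hf hx

/-- `∂_J` and `∂_{x_h}` commute (rotations commute with dilations). [folklore] -/
theorem cylDeriv_rotGen_horizontalProj_comm {f : ℝ³ → F} (hf : ContDiffOn ℝ ∞ f 𝕂) {x : ℝ³}
    (hx : x ∈ 𝕂) :
    cylDeriv rotGen (cylDeriv (fun y => horizontalProj y) f) x =
      cylDeriv (fun y => horizontalProj y) (cylDeriv rotGen f) x := by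
  refine cylDeriv_comm (W := fun y => horizontalProj y) (hasFDerivAt_rotGen x).differentiableAt
    horizontalProjL.differentiableAt ?_ hf hx
  rw [fderiv_horizontalProj, fderiv_rotGen]
  simp [horizontalProj_rotGen, rotGen_horizontalProj]

/-- `∂_J` and `∂₂` commute. [folklore] -/
theorem cylDeriv_rotGen_cylBasis_two_comm {f : ℝ³ → F} (hf : ContDiffOn ℝ ∞ f 𝕂) {x : ℝ³}
    (hx : x ∈ 𝕂) :
    cylDeriv rotGen (cylDeriv (fun _ => cylBasis 2) f) x =
      cylDeriv (fun _ => cylBasis 2) (cylDeriv rotGen f) x := by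
  refine cylDeriv_comm (hasFDerivAt_rotGen x).differentiableAt (differentiableAt_const _) ?_ hf hx
  rw [fderiv_rotGen]
  simp

/-- `∂_{x_h}` and `∂₂` commute. [folklore] -/
theorem cylDeriv_horizontalProj_cylBasis_two_comm {f : ℝ³ → F} (hf : ContDiffOn ℝ ∞ f 𝕂) {x : ℝ³}
    (hx : x ∈ 𝕂) :
    cylDeriv (fun y => horizontalProj y) (cylDeriv (fun _ => cylBasis 2) f) x =
      cylDeriv (fun _ => cylBasis 2) (cylDeriv (fun y => horizontalProj y) f) x := by
  refine cylDeriv_comm (V := fun y => horizontalProj y) horizontalProjL.differentiableAt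
    (differentiableAt_const _) ?_ hf hx
  rw [fderiv_horizontalProj]
  simp

/-- `[∂₀, ∂_J] = ∂₁`: `∂₀ ∂_J f − ∂_J ∂₀ f = ∂₁ f`. [folklore] -/
theorem cylDeriv_zero_rotGen_sub {f : ℝ³ → F} (hf : ContDiffOn ℝ ∞ f 𝕂) {x : ℝ³} (hx : x ∈ 𝕂) :
    cylDeriv (fun _ => cylBasis 0) (cylDeriv rotGen f) x - cylDeriv rotGen (cylDeriv (fun _ => cylBasis 0) f) x =
      cylDeriv (fun _ => cylBasis 1) f x := by
  rw [cylDeriv_comm_sub (differentiableAt_const _) (hasFDerivAt_rotGen x).differentiableAt hf hx]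
  refine cylDeriv_congr_field f ?_
  simp [fderiv_rotGen]

/-- `[∂₁, ∂_J] = −∂₀`: `∂₁ ∂_J f − ∂_J ∂₁ f = −∂₀ f`. [folklore] -/
theorem cylDeriv_one_rotGen_sub {f : ℝ³ → F} (hf : ContDiffOn ℝ ∞ f 𝕂) {x : ℝ³} (hx : x ∈ 𝕂) :
    cylDeriv (fun _ => cylBasis 1) (cylDeriv rotGen f) x - cylDeriv rotGen (cylDeriv (fun _ => cylBasis 1) f) x =
      -cylDeriv (fun _ => cylBasis 0) f x := by
  rw [cylDeriv_comm_sub (differentiableAt_const _) (hasFDerivAt_rotGen x).differentiableAt hf hx]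
  have : (fun y : ℝ³ => fderiv ℝ rotGen y (cylBasis 1) - fderiv ℝ (fun _ : ℝ³ => cylBasis 1) y (rotGen y)) =
      fun _ => -cylBasis 0 := by
    funext y; simp [fderiv_rotGen]
  rw [this]
  simp only [cylDeriv_apply, map_neg]

/-- `[∂₂, ∂_J] = 0`. [folklore] -/
theorem cylDeriv_two_rotGen_comm {f : ℝ³ → F} (hf : ContDiffOn ℝ ∞ f 𝕂) {x : ℝ³} (hx : x ∈ 𝕂) :
    cylDeriv (fun _ => cylBasis 2) (cylDeriv rotGen f) x = cylDeriv rotGen (cylDeriv (fun _ => cylBasis 2) f) x :=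
  (cylDeriv_rotGen_cylBasis_two_comm hf hx).symm

/-- `[∂ᵢ, ∂_{x_h}] = ∂_{(eᵢ)_h}`: `∂ᵢ ∂_{x_h} f − ∂_{x_h} ∂ᵢ f = ∂_{(eᵢ)_h} f`. [folklore] -/
theorem cylDeriv_cylBasis_horizontalProj_sub (i : Fin 3) {f : ℝ³ → F} (hf : ContDiffOn ℝ ∞ f 𝕂)
    {x : ℝ³} (hx : x ∈ 𝕂) :
    cylDeriv (fun _ => cylBasis i) (cylDeriv (fun y => horizontalProj y) f) x -
        cylDeriv (fun y => horizontalProj y) (cylDeriv (fun _ => cylBasis i) f) x =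
      cylDeriv (fun _ => horizontalProj (cylBasis i)) f x := by
  rw [cylDeriv_comm_sub (W := fun y => horizontalProj y) (differentiableAt_const _)
    horizontalProjL.differentiableAt hf hx]
  refine cylDeriv_congr_field f ?_
  simp [fderiv_horizontalProj]

/-! ### Periodicity and the wall -/

/-- **Derivatives of periodic functions along periodic fields are periodic.** [folklore] -/
theorem IsAxiallyPeriodic.cylDeriv {L : ℝ} {V : ℝ³ → ℝ³} {f : ℝ³ → F} (hf : IsAxiallyPeriodic L f)
    (hV : ∀ x, V (x + L • EuclideanSpace.single (2 : Fin 3) (1 : ℝ)) = V x) :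
    IsAxiallyPeriodic L (cylDeriv V f) := fun x => by
  have h := hf.fderivWithin_closure x
  dsimp only at h
  rw [cylDeriv_apply, cylDeriv_apply, h, hV x]

/-- Periodicity of word derivatives along periodic fields. [folklore] -/
theorem IsAxiallyPeriodic.cylWord {L : ℝ} {Vs : List (ℝ³ → ℝ³)} {f : ℝ³ → F} (hf : IsAxiallyPeriodic L f)
    (hVs : ∀ V ∈ Vs, ∀ x, V (x + L • EuclideanSpace.single (2 : Fin 3) (1 : ℝ)) = V x) :
    IsAxiallyPeriodic L (cylWord Vs f) := by
  induction Vs with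
  | nil => exact hf
  | cons V Vs ih =>
    exact (ih fun W hW => hVs W (List.mem_cons_of_mem _ hW)).cylDeriv (hVs V (List.mem_cons_self ..))

/-- The wall `{r = 1}` lies in the closed cylinder. [folklore] -/
theorem frontier_subset_K : frontier (unitCylinder : Set ℝ³) ⊆ 𝕂 := frontier_subset_closure

/-- **Tangential derivatives of a function vanishing on the wall vanish on the wall**, the
generator `J`: the curve `s ↦ R_s x` stays on the wall, has velocity `J x` at `s = 0`, and
`f ∘ R_· x ≡ 0`. [folklore] -/
theorem cylDeriv_rotGen_eq_zero_of_wall {f : ℝ³ → F} (hf : ContDiffOn ℝ ∞ f 𝕂)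
    (h0 : ∀ y ∈ frontier (unitCylinder : Set ℝ³), f y = 0) {x : ℝ³}
    (hx : x ∈ frontier (unitCylinder : Set ℝ³)) : cylDeriv rotGen f x = 0 := by
  have hxK : x ∈ 𝕂 := frontier_subset_K hx
  have hfd : HasFDerivWithinAt f (fderivWithin ℝ f 𝕂 x) 𝕂 x :=
    (differentiableWithinAt_K hf hxK).hasFDerivWithinAt
  have hγ : HasDerivWithinAt (fun s : ℝ => rotZ s x) (rotGen x) univ 0 :=
    (hasDerivAt_rotZ_zero x).hasDerivWithinAt
  have hmaps : MapsTo (fun s : ℝ => rotZ s x) univ 𝕂 := fun s _ =>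
    frontier_subset_K ((rotZ_mem_frontier_unitCylinder_iff s).2 hx)
  have h1 : HasDerivWithinAt (f ∘ fun s : ℝ => rotZ s x) (fderivWithin ℝ f 𝕂 x (rotGen x)) univ 0 := by
    have hfd' : HasFDerivWithinAt f (fderivWithin ℝ f 𝕂 x) 𝕂 (rotZ 0 x) := by rw [rotZ_zero]; exact hfd
    exact hfd'.comp_hasDerivWithinAt (0 : ℝ) hγ hmaps
  have h2 : (f ∘ fun s : ℝ => rotZ s x) = fun _ => (0 : F) := by
    funext s
    exact h0 _ ((rotZ_mem_frontier_unitCylinder_iff s).2 hx)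
  rw [h2, hasDerivWithinAt_univ] at h1
  rw [cylDeriv_apply]
  exact h1.unique (hasDerivAt_const (0 : ℝ) (0 : F))


/-- **Tangential derivatives of a function vanishing on the wall vanish on the wall**, the axial
direction `e₂`: the line `s ↦ x + s e₂` stays on the wall. [folklore] -/
theorem cylDeriv_cylBasis_two_eq_zero_of_wall {f : ℝ³ → F} (hf : ContDiffOn ℝ ∞ f 𝕂)
    (h0 : ∀ y ∈ frontier (unitCylinder : Set ℝ³), f y = 0) {x : ℝ³}
    (hx : x ∈ frontier (unitCylinder : Set ℝ³)) : cylDeriv (fun _ => cylBasis 2) f x = 0 := by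
  have hxK : x ∈ 𝕂 := frontier_subset_K hx
  have hfd : HasFDerivWithinAt f (fderivWithin ℝ f 𝕂 x) 𝕂 x :=
    (differentiableWithinAt_K hf hxK).hasFDerivWithinAt
  have hwall : ∀ s : ℝ, x + s • cylBasis 2 ∈ frontier (unitCylinder : Set ℝ³) := fun s => by
    rw [frontier_unitCylinder] at hx ⊢
    rw [mem_setOf_eq, show cylBasis 2 = EuclideanSpace.single (2 : Fin 3) (1 : ℝ) from rfl,
      cylRadius_add_axialShift]
    exact hx
  have hγ' : HasDerivAt (fun s : ℝ => x + s • cylBasis 2) (cylBasis 2) 0 := by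
    have h := ((hasDerivAt_id (0 : ℝ)).smul_const (cylBasis 2)).const_add x
    simpa using h
  have hγ : HasDerivWithinAt (fun s : ℝ => x + s • cylBasis 2) (cylBasis 2) univ 0 := hγ'.hasDerivWithinAt
  have hmaps : MapsTo (fun s : ℝ => x + s • cylBasis 2) univ 𝕂 := fun s _ =>
    frontier_subset_K (hwall s)
  have h1 : HasDerivWithinAt (f ∘ fun s : ℝ => x + s • cylBasis 2)
      (fderivWithin ℝ f 𝕂 x (cylBasis 2)) univ 0 := by
    have hfd' : HasFDerivWithinAt f (fderivWithin ℝ f 𝕂 x) 𝕂 (x + (0 : ℝ) • cylBasis 2) := by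
      rw [zero_smul, add_zero]; exact hfd
    exact hfd'.comp_hasDerivWithinAt (0 : ℝ) hγ hmaps
  have h2 : (f ∘ fun s : ℝ => x + s • cylBasis 2) = fun _ => (0 : F) := by
    funext s
    exact h0 _ (hwall s)
  rw [h2, hasDerivWithinAt_univ] at h1
  rw [cylDeriv_apply]
  exact h1.unique (hasDerivAt_const (0 : ℝ) (0 : F))

/-- A tangential derivative `a ∂_J + b ∂₂` of a function vanishing on the wall vanishes on the wall.
[folklore] -/
theorem cylDeriv_eq_zero_of_wall_of_tangent {f : ℝ³ → F} (hf : ContDiffOn ℝ ∞ f 𝕂)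
    (h0 : ∀ y ∈ frontier (unitCylinder : Set ℝ³), f y = 0) {V : ℝ³ → ℝ³} {x : ℝ³}
    (hx : x ∈ frontier (unitCylinder : Set ℝ³)) {a b : ℝ} (hV : V x = a • rotGen x + b • cylBasis 2) :
    cylDeriv V f x = 0 := by
  rw [cylDeriv_apply, hV, map_add, map_smul, map_smul, ← cylDeriv_apply rotGen,
    ← cylDeriv_apply (fun _ => cylBasis 2), cylDeriv_rotGen_eq_zero_of_wall hf h0 hx,
    cylDeriv_cylBasis_two_eq_zero_of_wall hf h0 hx, smul_zero, smul_zero, add_zero]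

end Fields

/-! ### Gradient, divergence and Laplacian within the closed cylinder -/

section GradDivLap

variable {F : Type*} [NormedAddCommGroup F] [NormedSpace ℝ F]

/-- The gradient within the closed cylinder: `Σᵢ (∂ᵢ f) eᵢ`; on the open cylinder it is the
classical gradient. [folklore] -/
def cylGrad (f : ℝ³ → ℝ) : ℝ³ → ℝ³ := fun x => ∑ i, cylDeriv (fun _ => cylBasis i) f x • cylBasis i

/-- The divergence within the closed cylinder: `Σᵢ (∂ᵢ W)ᵢ`; on the open cylinder it is the
classical divergence. [folklore] -/
def cylDiv (W : ℝ³ → ℝ³) : ℝ³ → ℝ := fun x => ∑ i, cylDeriv (fun _ => cylBasis i) W x i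

/-- The Laplacian within the closed cylinder: `Σᵢ ∂ᵢ ∂ᵢ f`. [folklore] -/
def cylLap (f : ℝ³ → F) : ℝ³ → F :=
  fun x => ∑ i, cylDeriv (fun _ => cylBasis i) (cylDeriv (fun _ => cylBasis i) f) x

/-- Unfolding `cylGrad`. [folklore] -/
theorem cylGrad_apply (f : ℝ³ → ℝ) (x : ℝ³) :
    cylGrad f x = ∑ i, cylDeriv (fun _ => cylBasis i) f x • cylBasis i := rfl

/-- Unfolding `cylDiv`. [folklore] -/
theorem cylDiv_apply (W : ℝ³ → ℝ³) (x : ℝ³) :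
    cylDiv W x = ∑ i, cylDeriv (fun _ => cylBasis i) W x i := rfl

/-- Unfolding `cylLap`. [folklore] -/
theorem cylLap_apply (f : ℝ³ → F) (x : ℝ³) :
    cylLap f x = ∑ i, cylDeriv (fun _ => cylBasis i) (cylDeriv (fun _ => cylBasis i) f) x := rfl

/-- The gradient within represents the derivative within: `⟪∇_K f (x), v⟫ = D f|_K (x) v`. [folklore] -/
theorem inner_cylGrad_left (f : ℝ³ → ℝ) (x v : ℝ³) : ⟪cylGrad f x, v⟫ = fderivWithin ℝ f 𝕂 x v := by
  rw [cylGrad_apply, sum_inner]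
  simp only [inner_smul_left, RCLike.conj_to_real, inner_cylBasis_left, cylDeriv_apply]
  conv_rhs => rw [← sum_apply_smul_cylBasis v]
  rw [map_sum]
  simp only [map_smul, smul_eq_mul, mul_comm]

/-- `⟪v, ∇_K f (x)⟫ = D f|_K (x) v`. [folklore] -/
theorem inner_cylGrad_right (f : ℝ³ → ℝ) (x v : ℝ³) : ⟪v, cylGrad f x⟫ = fderivWithin ℝ f 𝕂 x v := by
  rw [real_inner_comm, inner_cylGrad_left]

/-- `⟪∇_K f, V⟫ = ∂_V f`. [folklore] -/
theorem inner_cylGrad_eq_cylDeriv (f : ℝ³ → ℝ) (V : ℝ³ → ℝ³) (x : ℝ³) :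
    ⟪cylGrad f x, V x⟫ = cylDeriv V f x := inner_cylGrad_left f x (V x)

/-- The gradient within is the Riesz representative of the derivative within. [folklore] -/
theorem cylGrad_eq_toDual_symm (f : ℝ³ → ℝ) (x : ℝ³) :
    cylGrad f x = (InnerProductSpace.toDual ℝ ℝ³).symm (fderivWithin ℝ f 𝕂 x) := by
  refine ext_inner_right ℝ fun v => ?_
  rw [inner_cylGrad_left, InnerProductSpace.toDual_symm_apply]

/-- `‖∇_K f (x)‖ = ‖D f|_K (x)‖`. [folklore] -/
theorem norm_cylGrad (f : ℝ³ → ℝ) (x : ℝ³) : ‖cylGrad f x‖ = ‖fderivWithin ℝ f 𝕂 x‖ := by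
  rw [cylGrad_eq_toDual_symm, LinearIsometryEquiv.norm_map]

/-- **On the open cylinder the gradient within is the classical gradient.** [folklore] -/
theorem cylGrad_eq_gradient (f : ℝ³ → ℝ) {x : ℝ³} (hx : x ∈ (unitCylinder : Set ℝ³)) :
    cylGrad f x = gradient f x := by
  rw [cylGrad_eq_toDual_symm, gradient, fderivWithin_of_mem_nhds (closure_unitCylinder_mem_nhds hx)]

/-- **On the open cylinder the divergence within is the classical divergence.** [folklore] -/
theorem cylDiv_eq_divergence (W : ℝ³ → ℝ³) {x : ℝ³} (hx : x ∈ (unitCylinder : Set ℝ³)) :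
    cylDiv W x = VectorCalculus.divergence W x := by
  rw [cylDiv_apply, divergence_eq_sum_fderiv_single]
  refine Finset.sum_congr rfl fun i _ => ?_
  rw [cylDeriv_eq_fderiv _ _ hx]; rfl

/-- The gradient within is smooth on the closed cylinder. [folklore] -/
theorem contDiffOn_cylGrad {f : ℝ³ → ℝ} (hf : ContDiffOn ℝ ∞ f 𝕂) : ContDiffOn ℝ ∞ (cylGrad f) 𝕂 :=
  ContDiffOn.sum fun _ _ => (contDiffOn_cylDeriv contDiff_const hf).smul contDiffOn_const

/-- The divergence within is smooth on the closed cylinder. [folklore] -/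
theorem contDiffOn_cylDiv {W : ℝ³ → ℝ³} (hW : ContDiffOn ℝ ∞ W 𝕂) : ContDiffOn ℝ ∞ (cylDiv W) 𝕂 := by
  refine ContDiffOn.sum fun i _ => ?_
  exact (EuclideanSpace.proj (𝕜 := ℝ) i).contDiff.comp_contDiffOn (contDiffOn_cylDeriv contDiff_const hW)

/-- The Laplacian within is smooth on the closed cylinder. [folklore] -/
theorem contDiffOn_cylLap {f : ℝ³ → F} (hf : ContDiffOn ℝ ∞ f 𝕂) : ContDiffOn ℝ ∞ (cylLap f) 𝕂 :=
  ContDiffOn.sum fun _ _ => contDiffOn_cylDeriv contDiff_const (contDiffOn_cylDeriv contDiff_const hf)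

/-- The partial derivative of the gradient within: `∂_V ∇_K f = Σᵢ (∂_V ∂ᵢ f) eᵢ`. [folklore] -/
theorem cylDeriv_cylGrad {f : ℝ³ → ℝ} (hf : ContDiffOn ℝ ∞ f 𝕂) (V : ℝ³ → ℝ³) {x : ℝ³} (hx : x ∈ 𝕂) :
    cylDeriv V (cylGrad f) x = ∑ i, cylDeriv V (cylDeriv (fun _ => cylBasis i) f) x • cylBasis i := by
  rw [show cylGrad f = fun y => ∑ i, cylDeriv (fun _ => cylBasis i) f y • cylBasis i from rfl,
    cylDeriv_finset_sum (f := fun i y => cylDeriv (fun _ => cylBasis i) f y • cylBasis i) _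
      (fun i _ => (contDiffOn_cylDeriv contDiff_const hf).smul contDiffOn_const) hx]
  refine Finset.sum_congr rfl fun i _ => ?_
  rw [cylDeriv_smul (contDiffOn_cylDeriv contDiff_const hf) contDiffOn_const hx, cylDeriv_const,
    smul_zero, add_zero]

/-- `div_K ∇_K f = Δ_K f` on the closed cylinder. [folklore] -/
theorem cylDiv_cylGrad {f : ℝ³ → ℝ} (hf : ContDiffOn ℝ ∞ f 𝕂) {x : ℝ³} (hx : x ∈ 𝕂) :
    cylDiv (cylGrad f) x = cylLap f x := by
  rw [cylDiv_apply, cylLap_apply]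
  refine Finset.sum_congr rfl fun i _ => ?_
  rw [cylDeriv_cylGrad hf _ hx]
  simp [Fin.sum_univ_three, cylBasis_apply]
  fin_cases i <;> simp

/-- **On the open cylinder `div (∇f) = Δ_K f`** for `f` smooth on the closed cylinder (the classical
divergence of the classical gradient). [folklore] -/
theorem divergence_gradient_eq_cylLap {f : ℝ³ → ℝ} (hf : ContDiffOn ℝ ∞ f 𝕂) {x : ℝ³}
    (hx : x ∈ (unitCylinder : Set ℝ³)) : VectorCalculus.divergence (gradient f) x = cylLap f x := by
  have hev : gradient f =ᶠ[𝓝 x] cylGrad f :=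
    Filter.eventuallyEq_of_mem (unitCylinder.isOpen.mem_nhds hx) fun y hy => (cylGrad_eq_gradient f hy).symm
  unfold VectorCalculus.divergence
  rw [hev.fderiv_eq]
  change VectorCalculus.divergence (cylGrad f) x = cylLap f x
  rw [← cylDiv_eq_divergence _ hx, cylDiv_cylGrad hf (subset_closure hx)]

/-- `‖Δ_K f (x)‖ ≤ Σᵢ ‖∂ᵢ ∂ᵢ f (x)‖`. [folklore] -/
theorem norm_cylLap_le (f : ℝ³ → F) (x : ℝ³) :
    ‖cylLap f x‖ ≤ ∑ i, ‖cylDeriv (fun _ => cylBasis i) (cylDeriv (fun _ => cylBasis i) f) x‖ :=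
  norm_sum_le _ _

/-- The Laplacian within commutes with the partial derivatives. [folklore] -/
theorem cylLap_cylDeriv_const {f : ℝ³ → F} (hf : ContDiffOn ℝ ∞ f 𝕂) (v : ℝ³) {x : ℝ³} (hx : x ∈ 𝕂) :
    cylLap (cylDeriv (fun _ => v) f) x = cylDeriv (fun _ => v) (cylLap f) x := by
  rw [cylLap_apply, show cylLap f = fun y => ∑ i, cylDeriv (fun _ => cylBasis i)
    (cylDeriv (fun _ => cylBasis i) f) y from rfl, cylDeriv_finset_sum _ (fun i _ =>
      contDiffOn_cylDeriv contDiff_const (contDiffOn_cylDeriv contDiff_const hf)) hx]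
  refine Finset.sum_congr rfl fun i _ => ?_
  have h1 : EqOn (cylDeriv (fun _ => cylBasis i) (cylDeriv (fun _ => v) f))
      (cylDeriv (fun _ => v) (cylDeriv (fun _ => cylBasis i) f)) 𝕂 := fun y hy =>
    cylDeriv_const_comm _ _ hf hy
  rw [cylDeriv_congr h1 hx, cylDeriv_const_comm _ _ (contDiffOn_cylDeriv contDiff_const hf) hx]

/-- **The Laplacian within commutes with the rotation generator**: `Δ_K ∂_J f = ∂_J Δ_K f` on the
closed cylinder (`[∂₀, ∂_J] = ∂₁`, `[∂₁, ∂_J] = −∂₀`, `[∂₂, ∂_J] = 0`, and the cross terms cancel).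
[folklore] -/
theorem cylLap_cylDeriv_rotGen {f : ℝ³ → F} (hf : ContDiffOn ℝ ∞ f 𝕂) {x : ℝ³} (hx : x ∈ 𝕂) :
    cylLap (cylDeriv rotGen f) x = cylDeriv rotGen (cylLap f) x := by
  -- notation
  set D : Fin 3 → (ℝ³ → F) → ℝ³ → F := fun i g => cylDeriv (fun _ => cylBasis i) g with hD
  set T : (ℝ³ → F) → ℝ³ → F := fun g => cylDeriv rotGen g with hT
  have hDs : ∀ i {g : ℝ³ → F}, ContDiffOn ℝ ∞ g 𝕂 → ContDiffOn ℝ ∞ (D i g) 𝕂 := fun i g hg =>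
    contDiffOn_cylDeriv contDiff_const hg
  have hTs : ∀ {g : ℝ³ → F}, ContDiffOn ℝ ∞ g 𝕂 → ContDiffOn ℝ ∞ (T g) 𝕂 := fun hg =>
    contDiffOn_cylDeriv contDiff_rotGen hg
  -- the commutators, as identities of functions on the closed cylinder
  have c0 : ∀ {g : ℝ³ → F}, ContDiffOn ℝ ∞ g 𝕂 → EqOn (D 0 (T g)) (fun y => T (D 0 g) y + D 1 g y) 𝕂 :=
    fun hg y hy => by
      have := cylDeriv_zero_rotGen_sub hg hy
      simp only [hD, hT] at this ⊢
      rw [← this]; abel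
  have c1 : ∀ {g : ℝ³ → F}, ContDiffOn ℝ ∞ g 𝕂 → EqOn (D 1 (T g)) (fun y => T (D 1 g) y - D 0 g y) 𝕂 :=
    fun hg y hy => by
      have := cylDeriv_one_rotGen_sub hg hy
      simp only [hD, hT] at this ⊢
      rw [sub_eq_add_neg, ← this]; abel
  have c2 : ∀ {g : ℝ³ → F}, ContDiffOn ℝ ∞ g 𝕂 → EqOn (D 2 (T g)) (T (D 2 g)) 𝕂 :=
    fun hg y hy => cylDeriv_two_rotGen_comm hg hy
  -- second order
  have e0 : D 0 (D 0 (T f)) x = T (D 0 (D 0 f)) x + D 1 (D 0 f) x + D 0 (D 1 f) x := by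
    rw [show D 0 (D 0 (T f)) x = cylDeriv (fun _ => cylBasis 0) (D 0 (T f)) x from rfl,
      cylDeriv_congr (c0 hf) hx, cylDeriv_add (hTs (hDs 0 hf)) (hDs 1 hf) hx]
    have := c0 (hDs 0 hf) hx
    simp only [hD, hT] at this ⊢
    rw [this]
  have e1 : D 1 (D 1 (T f)) x = T (D 1 (D 1 f)) x - D 0 (D 1 f) x - D 1 (D 0 f) x := by
    rw [show D 1 (D 1 (T f)) x = cylDeriv (fun _ => cylBasis 1) (D 1 (T f)) x from rfl,
      cylDeriv_congr (c1 hf) hx, cylDeriv_sub (hTs (hDs 1 hf)) (hDs 0 hf) hx]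
    have := c1 (hDs 1 hf) hx
    simp only [hD, hT] at this ⊢
    rw [this]
  have e2 : D 2 (D 2 (T f)) x = T (D 2 (D 2 f)) x := by
    rw [show D 2 (D 2 (T f)) x = cylDeriv (fun _ => cylBasis 2) (D 2 (T f)) x from rfl,
      cylDeriv_congr (c2 hf) hx]
    exact c2 (hDs 2 hf) hx
  -- the right-hand side
  have hr : T (cylLap f) x = T (D 0 (D 0 f)) x + T (D 1 (D 1 f)) x + T (D 2 (D 2 f)) x := by
    simp only [hT]
    rw [show cylLap f = fun y => ∑ i, cylDeriv (fun _ => cylBasis i)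
      (cylDeriv (fun _ => cylBasis i) f) y from rfl,
      cylDeriv_finset_sum _ (fun i _ => hDs i (hDs i hf)) hx]
    simp [Fin.sum_univ_three, hD]
  change cylLap (T f) x = T (cylLap f) x
  rw [hr, cylLap_apply]
  simp only [Fin.sum_univ_three]
  change D 0 (D 0 (T f)) x + D 1 (D 1 (T f)) x + D 2 (D 2 (T f)) x = _
  rw [e0, e1, e2]
  have hsym : D 0 (D 1 f) x = D 1 (D 0 f) x := cylDeriv_const_comm _ _ hf hx
  rw [hsym]
  abel

/-- **`∂_{x_h}` commutes with `∂_J` on the Laplacian level too**: recorded in the form needed for the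
Neumann boundary operator, `∂_{x_h} ∂_J f = ∂_J ∂_{x_h} f`, as an identity of functions on the closed
cylinder. [folklore] -/
theorem eqOn_cylDeriv_horizontalProj_rotGen {f : ℝ³ → F} (hf : ContDiffOn ℝ ∞ f 𝕂) :
    EqOn (cylDeriv (fun y => horizontalProj y) (cylDeriv rotGen f))
      (cylDeriv rotGen (cylDeriv (fun y => horizontalProj y) f)) 𝕂 :=
  fun _ hx => (cylDeriv_rotGen_horizontalProj_comm hf hx).symm

/-! ### `r² Δ_h = (x_h·∇)² + ∂_J²` -/

/-- The derivative within the closed cylinder of a coordinate function along a field is the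
corresponding component of the field. [folklore] -/
theorem cylDeriv_coord (V : ℝ³ → ℝ³) (i : Fin 3) {x : ℝ³} (hx : x ∈ 𝕂) :
    cylDeriv V (fun y : ℝ³ => y i) x = V x i := by
  have hd : HasFDerivAt (fun y : ℝ³ => y i) (PiLp.proj 2 (fun _ : Fin 3 => ℝ) i) x :=
    PiLp.hasFDerivAt_apply (𝕜 := ℝ) 2 x i
  rw [cylDeriv_apply, hd.hasFDerivWithinAt.fderivWithin (uniqueDiffOn_K x hx)]
  rfl

/-- The coordinate functions are smooth. [folklore] -/
theorem contDiff_cylCoordFun (i : Fin 3) : ContDiff ℝ ∞ (fun y : ℝ³ => y i) :=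
  (EuclideanSpace.proj (𝕜 := ℝ) i).contDiff

/-- `∂ᵥ (yᵢ g) = vᵢ g + xᵢ ∂ᵥ g` on the closed cylinder. [folklore] -/
theorem cylDeriv_coord_smul (v : ℝ³) (i : Fin 3) {g : ℝ³ → F} (hg : ContDiffOn ℝ ∞ g 𝕂) {x : ℝ³}
    (hx : x ∈ 𝕂) :
    cylDeriv (fun _ => v) (fun y : ℝ³ => y i • g y) x = v i • g x + x i • cylDeriv (fun _ => v) g x := by
  rw [cylDeriv_smul (contDiff_cylCoordFun i).contDiffOn hg hx, cylDeriv_coord _ i hx]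

/-- **The polar identity for the horizontal Laplacian**:
`r² (∂₀² f + ∂₁² f) = ∂_{x_h} ∂_{x_h} f + ∂_J ∂_J f` on the closed cylinder (`r² = x₀² + x₁²`,
`∂_{x_h} = x₀∂₀ + x₁∂₁ = r ∂_r`, `∂_J = x₀∂₁ − x₁∂₀ = ∂_θ`); the first-order and mixed terms cancel
exactly. [folklore] -/
theorem sq_radius_smul_horizontalLap {f : ℝ³ → F} (hf : ContDiffOn ℝ ∞ f 𝕂) {x : ℝ³} (hx : x ∈ 𝕂) :
    (x 0 ^ 2 + x 1 ^ 2) • (cylDeriv (fun _ => cylBasis 0) (cylDeriv (fun _ => cylBasis 0) f) x +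
        cylDeriv (fun _ => cylBasis 1) (cylDeriv (fun _ => cylBasis 1) f) x) =
      cylDeriv (fun y => horizontalProj y) (cylDeriv (fun y => horizontalProj y) f) x +
        cylDeriv rotGen (cylDeriv rotGen f) x := by
  have hs : ∀ (i : Fin 3) {g : ℝ³ → F}, ContDiffOn ℝ ∞ g 𝕂 →
      ContDiffOn ℝ ∞ (cylDeriv (fun _ => cylBasis i) g) 𝕂 := fun i g hg =>
    contDiffOn_cylDeriv contDiff_const hg
  have sm : ∀ (i : Fin 3) {g : ℝ³ → F}, ContDiffOn ℝ ∞ g 𝕂 → ContDiffOn ℝ ∞ (fun y : ℝ³ => y i • g y) 𝕂 :=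
    fun i g hg => (contDiff_cylCoordFun i).contDiffOn.smul hg
  -- the two first-order operators as combinations of partial derivatives (everywhere)
  have hR : cylDeriv (fun y => horizontalProj y) f = fun y : ℝ³ =>
      y 0 • cylDeriv (fun _ => cylBasis 0) f y + y 1 • cylDeriv (fun _ => cylBasis 1) f y :=
    funext fun y => cylDeriv_horizontalProj_eq f y
  have hT : cylDeriv rotGen f = fun y : ℝ³ =>
      y 0 • cylDeriv (fun _ => cylBasis 1) f y - y 1 • cylDeriv (fun _ => cylBasis 0) f y :=
    funext fun y => cylDeriv_rotGen_eq f y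
  -- partial derivatives of these combinations
  have hRi : ∀ i : Fin 3, cylDeriv (fun _ => cylBasis i) (fun y : ℝ³ =>
      y 0 • cylDeriv (fun _ => cylBasis 0) f y + y 1 • cylDeriv (fun _ => cylBasis 1) f y) x =
      (cylBasis i 0 • cylDeriv (fun _ => cylBasis 0) f x +
        x 0 • cylDeriv (fun _ => cylBasis i) (cylDeriv (fun _ => cylBasis 0) f) x) +
      (cylBasis i 1 • cylDeriv (fun _ => cylBasis 1) f x +
        x 1 • cylDeriv (fun _ => cylBasis i) (cylDeriv (fun _ => cylBasis 1) f) x) := fun i => by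
    rw [cylDeriv_add (sm 0 (hs 0 hf)) (sm 1 (hs 1 hf)) hx, cylDeriv_coord_smul _ 0 (hs 0 hf) hx,
      cylDeriv_coord_smul _ 1 (hs 1 hf) hx]
  have hTi : ∀ i : Fin 3, cylDeriv (fun _ => cylBasis i) (fun y : ℝ³ =>
      y 0 • cylDeriv (fun _ => cylBasis 1) f y - y 1 • cylDeriv (fun _ => cylBasis 0) f y) x =
      (cylBasis i 0 • cylDeriv (fun _ => cylBasis 1) f x +
        x 0 • cylDeriv (fun _ => cylBasis i) (cylDeriv (fun _ => cylBasis 1) f) x) -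
      (cylBasis i 1 • cylDeriv (fun _ => cylBasis 0) f x +
        x 1 • cylDeriv (fun _ => cylBasis i) (cylDeriv (fun _ => cylBasis 0) f) x) := fun i => by
    rw [cylDeriv_sub (sm 0 (hs 1 hf)) (sm 1 (hs 0 hf)) hx, cylDeriv_coord_smul _ 0 (hs 1 hf) hx,
      cylDeriv_coord_smul _ 1 (hs 0 hf) hx]
  -- expand both second-order operators
  have eR : cylDeriv (fun y => horizontalProj y) (cylDeriv (fun y => horizontalProj y) f) x =
      x 0 • (cylDeriv (fun _ => cylBasis 0) f x +
        x 0 • cylDeriv (fun _ => cylBasis 0) (cylDeriv (fun _ => cylBasis 0) f) x +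
        x 1 • cylDeriv (fun _ => cylBasis 0) (cylDeriv (fun _ => cylBasis 1) f) x) +
      x 1 • (cylDeriv (fun _ => cylBasis 1) f x +
        x 0 • cylDeriv (fun _ => cylBasis 1) (cylDeriv (fun _ => cylBasis 0) f) x +
        x 1 • cylDeriv (fun _ => cylBasis 1) (cylDeriv (fun _ => cylBasis 1) f) x) := by
    rw [hR, cylDeriv_horizontalProj_eq, hRi 0, hRi 1]
    simp only [cylBasis_apply]
    simp only [Fin.isValue, ↓reduceIte, one_smul, Fin.one_eq_zero_iff, OfNat.ofNat_ne_one,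
      zero_smul, zero_add, Fin.zero_eq_one_iff]
    module
  have eT : cylDeriv rotGen (cylDeriv rotGen f) x =
      x 0 • (x 0 • cylDeriv (fun _ => cylBasis 1) (cylDeriv (fun _ => cylBasis 1) f) x -
        (cylDeriv (fun _ => cylBasis 0) f x +
          x 1 • cylDeriv (fun _ => cylBasis 1) (cylDeriv (fun _ => cylBasis 0) f) x)) -
      x 1 • (cylDeriv (fun _ => cylBasis 1) f x +
        x 0 • cylDeriv (fun _ => cylBasis 0) (cylDeriv (fun _ => cylBasis 1) f) x -
        x 1 • cylDeriv (fun _ => cylBasis 0) (cylDeriv (fun _ => cylBasis 0) f) x) := by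
    rw [hT, cylDeriv_rotGen_eq, hTi 0, hTi 1]
    simp only [cylBasis_apply]
    simp only [Fin.isValue, ↓reduceIte, one_smul, Fin.one_eq_zero_iff, OfNat.ofNat_ne_one,
      zero_smul, zero_add, Fin.zero_eq_one_iff]
  rw [eR, eT]
  module

end GradDivLap

/-! ### Integral identities on the period cell -/

section Integrals

/-- `⟪v, ∇θ(x)⟫ = Dθ(x)(v)` (Riesz representation). [folklore] -/
theorem inner_gradient_eq_fderiv (θ : ℝ³ → ℝ) (x v : ℝ³) : ⟪v, gradient θ x⟫ = fderiv ℝ θ x v := by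
  rw [real_inner_comm, gradient, InnerProductSpace.toDual_symm_apply]

/-- The generator is tangential on the wall: `⟪J x, e_r(x)⟫ = 0`. [folklore] -/
theorem inner_rotGen_eR (x : ℝ³) : ⟪rotGen x, eR x⟫ = 0 := by
  simp only [eR, inner_smul_right]
  rw [inner_rotGen_left]
  simp only [Matrix.cons_val_one, Matrix.cons_val_zero]
  ring

/-- The axial direction is tangential on the wall: `⟪e₂, e_r(x)⟫ = 0`. [folklore] -/
theorem inner_cylBasis_two_eR (x : ℝ³) : ⟪cylBasis 2, eR x⟫ = 0 := by
  rw [inner_cylBasis_left]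
  simp [eR]

/-- The generator is divergence free (`tr J = 0`). [folklore] -/
theorem divergence_rotGen_eq_zero (x : ℝ³) : VectorCalculus.divergence rotGen x = 0 := by
  rw [divergence_eq_sum_fderiv_single, fderiv_rotGen]
  simp [Fin.sum_univ_three, rotGen]

/-- A constant field is divergence free. [folklore] -/
theorem divergence_const (v : ℝ³) (x : ℝ³) : VectorCalculus.divergence (fun _ : ℝ³ => v) x = 0 := by
  simp [VectorCalculus.divergence]

variable {L : ℝ}

/-- **Integration by parts on the cell against a tangential periodic field**: for `φ` and `W` of
class `C¹` on the closed cylinder and `L`-periodic, `W` tangential on the wall,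
`∫_cell (φ div W + Dφ(W)) = ∫_cell div(φ W) = 0` (Gauss–Green on the period cell,
`setIntegral_divergence_cylinderCell_eq_zero`). [folklore] -/
theorem setIntegral_mul_divergence_add_fderiv_eq_zero (hL : 0 < L) {φ : ℝ³ → ℝ} {W : ℝ³ → ℝ³}
    (hφ : ContDiffOn ℝ 1 φ 𝕂) (hW : ContDiffOn ℝ 1 W 𝕂)
    (hslip : ∀ x ∈ frontier (unitCylinder : Set ℝ³), ⟪W x, eR x⟫ = 0)
    (hφp : IsAxiallyPeriodic L φ) (hWp : IsAxiallyPeriodic L W) :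
    ∫ x in (cylinderCell L : Set ℝ³), (φ x * VectorCalculus.divergence W x + fderiv ℝ φ x (W x)) = 0 := by
  set V : ℝ³ → ℝ³ := fun y => φ y • W y with hV
  have hVc : ContDiffOn ℝ 1 V 𝕂 := hφ.smul hW
  have hVslip : ∀ x ∈ frontier (unitCylinder : Set ℝ³), ⟪V x, eR x⟫ = 0 := fun x hx => by
    simp only [hV, inner_smul_left, hslip x hx, mul_zero]
  have hVper : IsAxiallyPeriodic L V := fun x => by simp only [hV, hφp x, hWp x]
  have hflux := setIntegral_divergence_cylinderCell_eq_zero hL hVc hVslip hVper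
  rw [← hflux]
  refine setIntegral_congr_fun (cylinderCell L).isOpen.measurableSet fun x hx => ?_
  have hxU : cylRadius x < 1 := cylinderCell_le_unitCylinder L hx
  have dφ : DifferentiableAt ℝ φ x := differentiableAt_of_contDiffOn_closure hφ hxU
  have dW : DifferentiableAt ℝ W x := differentiableAt_of_contDiffOn_closure hW hxU
  rw [hV, divergence_smul_apply dφ dW, inner_gradient_eq_fderiv]

/-- **`∫_cell ∂_J φ = 0`** for `φ` of class `C¹` on the closed cylinder and `L`-periodic (the generator
is tangential, periodic and divergence free). [folklore] -/
theorem setIntegral_cylDeriv_rotGen_eq_zero (hL : 0 < L) {φ : ℝ³ → ℝ} (hφ : ContDiffOn ℝ 1 φ 𝕂)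
    (hφp : IsAxiallyPeriodic L φ) :
    ∫ x in (cylinderCell L : Set ℝ³), cylDeriv rotGen φ x = 0 := by
  have h := setIntegral_mul_divergence_add_fderiv_eq_zero hL hφ
    (contDiff_rotGen.of_le (by exact_mod_cast le_top)).contDiffOn
    (fun x _ => inner_rotGen_eR x) hφp (fun x => rotGen_add_axialShift x L)
  rw [← h]
  refine setIntegral_congr_fun (cylinderCell L).isOpen.measurableSet fun x hx => ?_
  rw [divergence_rotGen_eq_zero, mul_zero, zero_add, cylDeriv_eq_fderiv _ _ (cylinderCell_le_unitCylinder L hx)]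

/-- **`∫_cell ∂₂ φ = 0`** for `φ` of class `C¹` on the closed cylinder and `L`-periodic (the periodic
ends cancel). [folklore] -/
theorem setIntegral_cylDeriv_cylBasis_two_eq_zero (hL : 0 < L) {φ : ℝ³ → ℝ} (hφ : ContDiffOn ℝ 1 φ 𝕂)
    (hφp : IsAxiallyPeriodic L φ) :
    ∫ x in (cylinderCell L : Set ℝ³), cylDeriv (fun _ => cylBasis 2) φ x = 0 := by
  have h := setIntegral_mul_divergence_add_fderiv_eq_zero hL hφ contDiffOn_const
    (fun x _ => inner_cylBasis_two_eR x) hφp (fun x => rfl)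
  rw [← h]
  refine setIntegral_congr_fun (cylinderCell L).isOpen.measurableSet fun x hx => ?_
  rw [divergence_const, mul_zero, zero_add, cylDeriv_eq_fderiv _ _ (cylinderCell_le_unitCylinder L hx)]

/-- A function continuous on the closed cylinder is integrable on the period cell. [folklore] -/
theorem integrableOn_cylinderCell_of_continuousOn_K {G : Type*} [NormedAddCommGroup G] (L : ℝ)
    {f : ℝ³ → G} (hf : ContinuousOn f 𝕂) : IntegrableOn f (cylinderCell L : Set ℝ³) volume :=
  ((hf.mono (closure_cylinderCell_subset L)).integrableOn_compact
    (isCompact_closure_cylinderCell L)).mono_set subset_closure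

/-- **Integration by parts for a tangential derivation**: if `∫_cell ∂_Z h = 0` for all smooth periodic
`h` (as for `Z = J` and `Z = e₂`), then `∫_cell (∂_Z f) g = −∫_cell f (∂_Z g)` for smooth periodic
`f, g`. [folklore] -/
theorem setIntegral_cylDeriv_mul_eq_neg {Z : ℝ³ → ℝ³} (hZ : ContDiff ℝ ∞ Z)
    (hZ0 : ∀ h : ℝ³ → ℝ, ContDiffOn ℝ ∞ h 𝕂 → IsAxiallyPeriodic L h →
      ∫ x in (cylinderCell L : Set ℝ³), cylDeriv Z h x = 0)
    {f g : ℝ³ → ℝ} (hf : ContDiffOn ℝ ∞ f 𝕂) (hg : ContDiffOn ℝ ∞ g 𝕂) (hfp : IsAxiallyPeriodic L f)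
    (hgp : IsAxiallyPeriodic L g) :
    ∫ x in (cylinderCell L : Set ℝ³), cylDeriv Z f x * g x =
      -∫ x in (cylinderCell L : Set ℝ³), f x * cylDeriv Z g x := by
  have h0 := hZ0 (fun y => f y * g y) (hf.mul hg) (fun x => by simp only [hfp x, hgp x])
  have hpt : ∀ x ∈ (cylinderCell L : Set ℝ³), cylDeriv Z (fun y => f y * g y) x =
      cylDeriv Z f x * g x + f x * cylDeriv Z g x := fun x hx =>
    cylDeriv_mul hf hg (subset_closure (cylinderCell_le_unitCylinder L hx))
  rw [setIntegral_congr_fun (cylinderCell L).isOpen.measurableSet hpt, integral_add] at h0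
  · linarith
  · exact integrableOn_cylinderCell_of_continuousOn_K L
      ((contDiffOn_cylDeriv hZ hf).continuousOn.mul hg.continuousOn)
  · exact integrableOn_cylinderCell_of_continuousOn_K L
      (hf.continuousOn.mul (contDiffOn_cylDeriv hZ hg).continuousOn)

/-- `∫_cell (∂_J f) g = −∫_cell f (∂_J g)`. [folklore] -/
theorem setIntegral_cylDeriv_rotGen_mul (hL : 0 < L) {f g : ℝ³ → ℝ} (hf : ContDiffOn ℝ ∞ f 𝕂)
    (hg : ContDiffOn ℝ ∞ g 𝕂) (hfp : IsAxiallyPeriodic L f) (hgp : IsAxiallyPeriodic L g) :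
    ∫ x in (cylinderCell L : Set ℝ³), cylDeriv rotGen f x * g x =
      -∫ x in (cylinderCell L : Set ℝ³), f x * cylDeriv rotGen g x :=
  setIntegral_cylDeriv_mul_eq_neg contDiff_rotGen
    (fun h hh hhp => setIntegral_cylDeriv_rotGen_eq_zero hL (hh.of_le (by exact_mod_cast le_top)) hhp)
    hf hg hfp hgp

/-- `∫_cell (∂₂ f) g = −∫_cell f (∂₂ g)`. [folklore] -/
theorem setIntegral_cylDeriv_cylBasis_two_mul (hL : 0 < L) {f g : ℝ³ → ℝ} (hf : ContDiffOn ℝ ∞ f 𝕂)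
    (hg : ContDiffOn ℝ ∞ g 𝕂) (hfp : IsAxiallyPeriodic L f) (hgp : IsAxiallyPeriodic L g) :
    ∫ x in (cylinderCell L : Set ℝ³), cylDeriv (fun _ => cylBasis 2) f x * g x =
      -∫ x in (cylinderCell L : Set ℝ³), f x * cylDeriv (fun _ => cylBasis 2) g x :=
  setIntegral_cylDeriv_mul_eq_neg contDiff_const
    (fun h hh hhp => setIntegral_cylDeriv_cylBasis_two_eq_zero hL (hh.of_le (by exact_mod_cast le_top)) hhp)
    hf hg hfp hgp

end Integrals



end Literature.Analysis.FluidPDE
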